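import Mathlib
import HarnessLib
import Summits.NavierStokesRegularity.NavierStokesRegularity.Theorems.PoloidalWindowDoorLrcModEntireQ4SonicSheetSpeedLaw
import Summits.NavierStokesRegularity.NavierStokesRegularity.Theorems.PoloidalWindowDoorLrcModEntireRidgeWebCurves
import Summits.NavierStokesRegularity.NavierStokesRegularity.Theorems.PoloidalWindowDoorLrcModEntireQ4SonicHotSheetTimeSplit

/-!
# Route `PoloidalWindowDoor`, item `LrcModEntire` (stmt-NavierStokesRegularity-20428), cell (Q4-sonic), slot `stub_Q4sonicLineNeg` —
# B-SPEED(τ), IV: THE WEB-SPEED LAW AT A SONIC TIME WITH PARALLEL WEBS, IN THE CURRENCY OF THE SPACE–TIME WEB PACKAGE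

Cell ns-regularity-ideate, helper seat ns-k2-port-2 g8 under the LEAD of item 20428 (ns-poloidal-K2-p3 g17; GO of 2026-08-29T18:51:51Z: «(line_web_package hyps) ∧
sonic at τ ∧ webs parallel at τ (B-T's conclusion as a HYPOTHESIS `n₀(τ,s,z) = n₀(τ,0,z)`) ⊢ `a·V = −(1+d′²)a₃ + a(U·Je − d′U₂(W)) − 2d′aμ_z/(1−μ)` at every web point of
time τ» — brick B-SPEEDτ of T2B-g17 §5(5g), feeding (5c) together with K2-p2's B-T); `--supports stmt-NavierStokesRegularity-20428 --as helper`.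

* ★★ `sonic_speed_law_of_package` — hypotheses: the class profile, `σ = ±1`, the (TH) slab law (`|t+1| < ρ`, `|x₂| < ρ`, `C³` slope), THE OUTPUT BLOCK OF
  `…Q4TimeWebPackage.time_web_package_line` for a given window `δ′ ≤ ρ`, `δ′ < 1/2`, web function `n₀` and ridge curvature `κ` (stated verbatim, with a horizontal
  unit vector `e` for `Γ′(0)`), a time `|τ| < δ′` which is SONIC (`R(τ,·)` affine on `|z| < δ′`) and at which the webs are PARALLEL (`n₀(τ,s,z) = n₀(τ,0,z)`).
  Conclusion, at every web point `W = frameCLM e (s, n₀(τ,s,z), z)`, `|z| < δ′`, with `θ = U₂(−1+τ,·)`, `a = D²θ(W)[Je,Je]`, `a₃ = D³θ(W)[Je,Je,Je]`, `d = n₀(τ,0,·)`,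
  `V = ∂_τn₀(τ,s,z)`, `μ = μ(−1+τ,z)`, `μ_z = ∂_zμ(−1+τ,z)`:
  **`V·a = −(1 + d′(z)²)·a₃ + a·(U(−1+τ,W)₁e₀ − U(−1+τ,W)₀e₁ − d′(z)·U₂(−1+τ,W)) − 2μ_z·d′(z)·a/(1 − μ)`.**
  The proof derives the sheet-level hypotheses of `…Q4SonicSheetSpeedLaw.sonic_sheet_speed_law`: `Dθ∘W ≡ σB·pr₂` (value identity `σU₂∘W = R(τ,z) = A + Bz`
  differentiated along the sheet + horizontal criticality), `d′² + μ = 0` (Huygens at `τ` with `∂_sn₀ = 0` and `R_zz(τ,·) = 0`), `a ≠ 0` (ridge law + null tangent `e`),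
  and the kinematic literal (`…RidgeWebCurves.spacetimeHessian_sheetVelocity_normal_eq_zero`).
* ★ `crossVelocity_of_package` — the same law solved for the cross-web velocity (T2B-g17 v4 §7 S3(b)), given `a ≠ 0`:
  `U(t,W)·Je = ∂_τn₀(τ,s,z) + (1−μ)·a₃/a + d′(z)·σR(τ,z) + 2μ_z·d′(z)/(1−μ)` (the sheet data — `σa = −κ(τ,z) ≠ 0`, null tangents, transport — are in
  `…Q4SonicSheetDataPackage.sonic_sheet_data_of_package`).
* `webSpeed_sfree_of_parallel` — parallel webs at all nearby times ⇒ `∂_τn₀(τ,s,z) = ∂_τn₀(τ,0,z)` (the web speed `V` is `s`-free in case I).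
WHAT THIS IS NOT: not a claim about Navier–Stokes regularity — an identity of the (TH) column in case I («every nearby time sonic») of the research slot
`stub_Q4sonicLineNeg` (registry twist_split v12); no stub is closed here; items 20428 / 19708 / 27893 OPEN.
-/

noncomputable section

set_option linter.dupNamespace false
set_option linter.style.longLine false

namespace Summit.NavierStokesRegularity.NavierStokesRegularity.Theorems.PoloidalWindowDoorLrcModEntireQ4SonicSpeedLawPackage

open Set Function Filter Topology Metric
open scoped RealInnerProductSpace InnerProductSpace Laplacian ContDiff
open Literature.Analysis Literature.Analysis.FluidPDE Literature.Analysis.UnboundedOperators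
open Summit.NavierStokesRegularity.NavierStokesRegularity.Theorems
open Summit.NavierStokesRegularity.NavierStokesRegularity.Theorems.LocalSineTubeDoorProfileAlignedWindowRigidityAncient
open Summit.NavierStokesRegularity.NavierStokesRegularity.Theorems.PoloidalWindowDoorPoloidalWindowRigidityWindow
open Summit.NavierStokesRegularity.NavierStokesRegularity.Theorems.PoloidalWindowDoorLrcModEntireSheetFlattenTools
open Summit.NavierStokesRegularity.NavierStokesRegularity.Theorems.PoloidalWindowDoorLrcModEntireParallelWebsIdentity
open Summit.NavierStokesRegularity.NavierStokesRegularity.Theorems.PoloidalWindowDoorLrcModEntireRidgeClassConstants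
open Summit.NavierStokesRegularity.NavierStokesRegularity.Theorems.PoloidalWindowDoorLrcModEntireRidgeWebCurves
open Summit.NavierStokesRegularity.NavierStokesRegularity.Theorems.PoloidalWindowDoorLrcModEntireQ4SonicHotSheetSecondPins
open Summit.NavierStokesRegularity.NavierStokesRegularity.Theorems.PoloidalWindowDoorLrcModEntireQ4SonicHotSheetTimeSplit
open Summit.NavierStokesRegularity.NavierStokesRegularity.Theorems.PoloidalWindowDoorLrcModEntireQ4SonicSheetNonHot
open Summit.NavierStokesRegularity.NavierStokesRegularity.Theorems.PoloidalWindowDoorLrcModEntireQ4SonicSheetSpeedLaw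

variable {C : ℝ} {U : ℝ → EuclideanSpace ℝ (Fin 3) → EuclideanSpace ℝ (Fin 3)} {R μ : ℝ → ℝ → ℝ} {σ r ρ δ' : ℝ} {e : EuclideanSpace ℝ (Fin 3)}
  {n₀ : ℝ × ℝ × ℝ → ℝ} {κt : ℝ → ℝ → ℝ}

/-- ★★ **THE WEB-SPEED LAW AT A SONIC TIME WITH PARALLEL WEBS (package currency; B-SPEEDτ of T2B-g17 §5(5g)).**  See the module docstring.  The hypothesis
`hpack` is the output block of `…Q4TimeWebPackage.time_web_package_line` (with `e = Γ′(0)`), `hson` the sonic literal at time `τ`, `hpar` the parallelism of the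
webs at time `τ` (K2-p2's brick B-T). -/
theorem sonic_speed_law_of_package
    (hrate : HasTypeITimeDecay C U) (hcont : ContinuousOn (uncurry U) (Iio (0 : ℝ) ×ˢ univ))
    (hmild : ∀ s t : ℝ, s < t → t < 0 → ∀ x, U t x = heatExtension (U s) (t - s) x - oseenDuhamel 1 s U U t x)
    (hdiv : ∀ t < 0, VectorCalculus.IsDivFree (U t))
    (hpol : ∀ s < 0, ∀ y, ⟪curl (U s) y, EuclideanSpace.single 2 1⟫_ℝ = 0)
    (hσ : σ = 1 ∨ σ = -1) (hμ3 : ContDiff ℝ 3 (uncurry μ))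
    (hslabU : ∀ t : ℝ, |t + 1| < ρ → ∀ x : EuclideanSpace ℝ (Fin 3), |x 2| < ρ → ∀ b : Fin 3, b ≠ 2 →
      fderiv ℝ (U t) x (EuclideanSpace.single 2 1) b = μ t (x 2) * fderiv ℝ (U t) x (EuclideanSpace.single b 1) 2)
    (hδ'ρ : δ' ≤ ρ) (hδ'h : δ' < 1 / 2) (he2 : e 2 = 0) (hunit : e 0 ^ 2 + e 1 ^ 2 = 1)
    (hpack : ∀ q : ℝ × ℝ × ℝ, |q.1| < δ' → |q.2.2| < δ' →
        n₀ q ∈ Ioo (-r) r ∧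
        σ * U (-1 + q.1) (frameCLM e (q.2.1, n₀ q, q.2.2)) 2 = R q.1 q.2.2 ∧
        (∀ n ∈ Icc (-r) r, n ≠ n₀ q → σ * U (-1 + q.1) (frameCLM e (q.2.1, n, q.2.2)) 2 < R q.1 q.2.2) ∧
        (∀ w : EuclideanSpace ℝ (Fin 3), w 2 = 0 → fderiv ℝ (fun y => U (-1 + q.1) y 2) (frameCLM e (q.2.1, n₀ q, q.2.2)) w = 0) ∧
        (∀ m : ℕ∞, ContDiffAt ℝ m n₀ q) ∧
        0 < κt q.1 q.2.2 ∧
        fderiv ℝ (fderiv ℝ (fun y => σ * U (-1 + q.1) y 2)) (frameCLM e (q.2.1, n₀ q, q.2.2)) e e +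
            fderiv ℝ (fderiv ℝ (fun y => σ * U (-1 + q.1) y 2)) (frameCLM e (q.2.1, n₀ q, q.2.2)) (Jvec e) (Jvec e) =
          -κt q.1 q.2.2 ∧
        κt q.1 q.2.2 * (fderiv ℝ n₀ q ((0 : ℝ), (0 : ℝ), (1 : ℝ))) ^ 2 =
          (deriv (deriv (R q.1)) q.2.2 - μ (-1 + q.1) q.2.2 * κt q.1 q.2.2) * (1 + (fderiv ℝ n₀ q ((0 : ℝ), (1 : ℝ), (0 : ℝ))) ^ 2))
    {τ : ℝ} (hτ : |τ| < δ') (hson : ∃ A B : ℝ, ∀ z : ℝ, |z| < δ' → R τ z = A + B * z)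
    (hpar : ∀ s z : ℝ, |z| < δ' → n₀ (τ, s, z) = n₀ (τ, (0 : ℝ), z)) (s : ℝ) {z : ℝ} (hz : |z| < δ') :
    fderiv ℝ n₀ (τ, s, z) ((1 : ℝ), (0 : ℝ), (0 : ℝ)) *
        fderiv ℝ (fderiv ℝ (fun y => U (-1 + τ) y 2)) (frameCLM e (s, n₀ (τ, s, z), z)) (Jvec e) (Jvec e) =
      -((1 + deriv (fun z' => n₀ (τ, (0 : ℝ), z')) z ^ 2) *
            fderiv ℝ (fderiv ℝ (fderiv ℝ (fun y => U (-1 + τ) y 2))) (frameCLM e (s, n₀ (τ, s, z), z)) (Jvec e) (Jvec e) (Jvec e))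
        + fderiv ℝ (fderiv ℝ (fun y => U (-1 + τ) y 2)) (frameCLM e (s, n₀ (τ, s, z), z)) (Jvec e) (Jvec e) *
            (U (-1 + τ) (frameCLM e (s, n₀ (τ, s, z), z)) 1 * e 0 - U (-1 + τ) (frameCLM e (s, n₀ (τ, s, z), z)) 0 * e 1
              - deriv (fun z' => n₀ (τ, (0 : ℝ), z')) z * U (-1 + τ) (frameCLM e (s, n₀ (τ, s, z), z)) 2)
        - 2 * deriv (μ (-1 + τ)) z * deriv (fun z' => n₀ (τ, (0 : ℝ), z')) z *
            fderiv ℝ (fderiv ℝ (fun y => U (-1 + τ) y 2)) (frameCLM e (s, n₀ (τ, s, z), z)) (Jvec e) (Jvec e) / (1 - μ (-1 + τ) z) := by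
  set t : ℝ := -1 + τ with ht_def
  have hτh : |τ| < 1 / 2 := lt_of_lt_of_le hτ hδ'h.le
  have hτρ : |τ| < ρ := lt_of_lt_of_le hτ hδ'ρ
  have ht : t < 0 := by rw [ht_def]; linarith [(abs_lt.1 hτh).2]
  have hδ' : 0 < δ' := lt_of_le_of_lt (abs_nonneg _) hz
  set θ : EuclideanSpace ℝ (Fin 3) → ℝ := fun y => U t y 2 with hθ_def
  set d : ℝ → ℝ := fun z' => n₀ (τ, (0 : ℝ), z') with hd_def
  set I : Set ℝ := Ioo (-δ') δ' with hI_def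
  have hI : IsOpen I := isOpen_Ioo
  have hImem : ∀ {z' : ℝ}, |z'| < δ' → z' ∈ I := fun hz' => by rw [hI_def, mem_Ioo]; exact ⟨by linarith [(abs_lt.1 hz').1], (abs_lt.1 hz').2⟩
  have hIabs : ∀ {z' : ℝ}, z' ∈ I → |z'| < δ' := fun hz' => by rw [hI_def, mem_Ioo] at hz'; exact abs_lt.2 ⟨by linarith [hz'.1], hz'.2⟩
  have hIρ : ∀ z' ∈ I, |z'| < ρ := fun z' hz' => lt_of_lt_of_le (hIabs hz') hδ'ρ
  /- regularity of the slice and of `n₀` -/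
  have hθsm : ∀ a : ℝ, -1 + a < 0 → ContDiff ℝ ∞ (fun y => U (-1 + a) y 2) := by
    intro a ha
    have hUan : AnalyticOnNhd ℝ (U (-1 + a)) univ := analyticOnNhd_slice hcont (bdd_of_hasTypeITimeDecay hrate) hmild ha
    have hθan : AnalyticOnNhd ℝ (fun y => U (-1 + a) y 2) univ := fun x _ =>
      ((EuclideanSpace.proj (𝕜 := ℝ) (2 : Fin 3)).analyticAt _).comp (hUan x (mem_univ _))
    exact hθan.contDiff
  have hθ : ContDiff ℝ ∞ θ := hθsm τ ht
  have hθ2 : ContDiff ℝ 2 θ := hθ.of_le (by norm_cast)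
  have hθd : Differentiable ℝ θ := hθ.differentiable (by simp)
  have hn₀d : ∀ s' z' : ℝ, |z'| < δ' → DifferentiableAt ℝ n₀ (τ, s', z') := fun s' z' hz' =>
    ((hpack (τ, s', z') hτ hz').2.2.2.2.1 1).differentiableAt (by simp)
  -- the web points at time `τ` lie on the straight sheet of `d`
  have hWeq : ∀ s' z' : ℝ, |z'| < δ' → frameCLM e (s', n₀ (τ, s', z'), z') = s' • e + d z' • Jvec e + z' • e2 := by
    intro s' z' hz'
    rw [frameCLM_apply, hpar s' z' hz']
  -- derivatives of `n₀` along the `z`- and `s`-lines at time `τ`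
  have hdz : ∀ s' z' : ℝ, |z'| < δ' → HasDerivAt (fun a : ℝ => n₀ (τ, s', a)) (fderiv ℝ n₀ (τ, s', z') ((0 : ℝ), (0 : ℝ), (1 : ℝ))) z' :=
    fun s' z' hz' => (hn₀d s' z' hz').hasFDerivAt.comp_hasDerivAt z' (hasDerivAt_zLine τ s' z')
  have hdd : ∀ z' : ℝ, |z'| < δ' → HasDerivAt d (fderiv ℝ n₀ (τ, (0 : ℝ), z') ((0 : ℝ), (0 : ℝ), (1 : ℝ))) z' := fun z' hz' => hdz 0 z' hz'
  have hns : ∀ z' : ℝ, |z'| < δ' → fderiv ℝ n₀ (τ, (0 : ℝ), z') ((0 : ℝ), (1 : ℝ), (0 : ℝ)) = 0 := by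
    intro z' hz'
    have h1 : HasDerivAt (fun a : ℝ => n₀ (τ, a, z')) (fderiv ℝ n₀ (τ, (0 : ℝ), z') ((0 : ℝ), (1 : ℝ), (0 : ℝ))) 0 :=
      (hn₀d 0 z' hz').hasFDerivAt.comp_hasDerivAt (0 : ℝ) (hasDerivAt_sLine τ z' 0)
    have h2 : HasDerivAt (fun a : ℝ => n₀ (τ, a, z')) 0 0 := by
      have e1 : (fun a : ℝ => n₀ (τ, a, z')) = fun _ => d z' := by funext a; exact hpar a z' hz'
      rw [e1]; exact hasDerivAt_const _ _
    exact h1.unique h2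
  /- the offset is smooth on the window -/
  have hd : ContDiffOn ℝ ∞ d I := by
    intro z' hz'
    have h := (hpack (τ, (0 : ℝ), z') hτ (hIabs hz')).2.2.2.2.1 ⊤
    have hline : ContDiff ℝ ∞ (fun a : ℝ => ((τ, (0 : ℝ), a) : ℝ × ℝ × ℝ)) :=
      contDiff_const.prodMk (contDiff_const.prodMk contDiff_id)
    exact (h.comp z' hline.contDiffAt).contDiffWithinAt
  /- the sonic literal: `R(τ,·) = A + B·z`, `R_z = B`, `R_zz = 0` on the window -/
  obtain ⟨A, B, hAB⟩ := hson
  have hRev : ∀ z' : ℝ, |z'| < δ' → (R τ) =ᶠ[𝓝 z'] fun z'' => A + B * z'' := by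
    intro z' hz'
    filter_upwards [hI.mem_nhds (hImem hz')] with z'' hz'' using hAB z'' (hIabs hz'')
  have hR'' : ∀ z' : ℝ, |z'| < δ' → deriv (deriv (R τ)) z' = 0 := by
    intro z' hz'
    have hev1 : deriv (R τ) =ᶠ[𝓝 z'] fun _ => B := by
      filter_upwards [(hRev z' hz').eventuallyEq_nhds] with z'' hz''
      have hdAB : HasDerivAt (fun z''' : ℝ => A + B * z''') B z'' := by
        simpa using ((hasDerivAt_id z'').const_mul B).const_add A
      rw [hz''.deriv_eq, hdAB.deriv]
    rw [hev1.deriv_eq, deriv_const]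
  /- (1) the characteristic relation `d′² + μ = 0` on the window -/
  have hQ0 : ∀ z' ∈ I, deriv d z' ^ 2 + μ (-1 + τ) z' = 0 := by
    intro z' hz'
    have hz'a := hIabs hz'
    obtain ⟨-, -, -, -, -, hκ, -, hH⟩ := hpack (τ, (0 : ℝ), z') hτ hz'a
    simp only at hH hκ
    rw [hns z' hz'a, hR'' z' hz'a, (hdd z' hz'a).deriv] at *
    have h2 : κt τ z' * (fderiv ℝ n₀ (τ, 0, z') (0, 0, 1) ^ 2 + μ (-1 + τ) z') = 0 := by nlinarith [hH]
    rcases mul_eq_zero.1 h2 with h3 | h3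
    · exact absurd h3 hκ.ne'
    · exact h3
  /- (2) the gradient of `θ` along the sheet is the fixed form `σB·pr₂` -/
  set c : EuclideanSpace ℝ (Fin 3) →L[ℝ] ℝ := (σ * B) • (EuclideanSpace.proj (𝕜 := ℝ) (2 : Fin 3)) with hc_def
  have hch : ∀ w : EuclideanSpace ℝ (Fin 3), w 2 = 0 → c w = 0 := fun w hw => by simp [hc_def, hw]
  have hσσ : σ * σ = 1 := by rcases hσ with h | h <;> simp [h]
  have hsheet : ∀ s' : ℝ, ∀ z' ∈ I, fderiv ℝ θ (s' • e + d z' • Jvec e + z' • e2) = c := by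
    intro s' z' hz'
    have hz'a := hIabs hz'
    obtain ⟨-, -, -, hhor, -, -, -, -⟩ := hpack (τ, s', z') hτ hz'a
    simp only at hhor
    rw [hWeq s' z' hz'a] at hhor
    set W' := s' • e + d z' • Jvec e + z' • e2 with hW'
    -- differentiate the value identity `σθ(W(s',z'')) = A + B z''` in `z''` at `z'`
    set nz := fderiv ℝ n₀ (τ, s', z') ((0 : ℝ), (0 : ℝ), (1 : ℝ)) with hnz
    have hP : HasDerivAt (fun a : ℝ => frameCLM e (s', n₀ (τ, s', a), a)) (frameCLM e ((0 : ℝ), nz, (1 : ℝ))) z' := by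
      have hin : HasDerivAt (fun a : ℝ => ((s', n₀ (τ, s', a), a) : ℝ × ℝ × ℝ)) ((0 : ℝ), nz, (1 : ℝ)) z' :=
        (hasDerivAt_const z' s').prodMk ((hdz s' z' hz'a).prodMk (hasDerivAt_id z'))
      exact (frameCLM e).hasFDerivAt.comp_hasDerivAt z' hin
    have hPz : frameCLM e (s', n₀ (τ, s', z'), z') = W' := by rw [hW', ← hWeq s' z' hz'a]
    have hg : HasDerivAt (fun a : ℝ => σ * U t (frameCLM e (s', n₀ (τ, s', a), a)) 2) (σ * fderiv ℝ θ W' (frameCLM e ((0 : ℝ), nz, (1 : ℝ)))) z' := by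
      have h := ((hθd _).hasFDerivAt.comp_hasDerivAt z' hP).const_mul σ
      rw [hPz] at h
      exact h
    have hev : (fun a : ℝ => σ * U t (frameCLM e (s', n₀ (τ, s', a), a)) 2) =ᶠ[𝓝 z'] fun a => A + B * a := by
      filter_upwards [hI.mem_nhds hz'] with a ha
      have hval := (hpack (τ, s', a) hτ (hIabs ha)).2.1
      simp only at hval
      rw [hval, hAB a (hIabs ha)]
    have hlin : HasDerivAt (fun a : ℝ => A + B * a) B z' := by simpa using ((hasDerivAt_id z').const_mul B).const_add A
    have hBeq : σ * fderiv ℝ θ W' (frameCLM e ((0 : ℝ), nz, (1 : ℝ))) = B := hg.unique (hlin.congr_of_eventuallyEq hev)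
    have hvert : fderiv ℝ θ W' e2 = σ * B := by
      rw [frameCLM_apply] at hBeq
      simp only [zero_smul, zero_add, one_smul, map_add, map_smul, smul_eq_mul] at hBeq
      rw [hhor (Jvec e) (by simp [Jvec]), mul_zero, zero_add] at hBeq
      rw [← hBeq, ← mul_assoc, hσσ, one_mul]
    ext w
    have hsplit : w = (w - w 2 • e2) + w 2 • e2 := by abel
    have hw0 : (w - w 2 • e2) 2 = 0 := by simp [e2]
    rw [hsplit, map_add, hhor _ hw0, map_smul, hvert, smul_eq_mul, zero_add]
    simp [hc_def, e2, mul_comm]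
  /- (3) `a ≠ 0` from the ridge law and the null tangent `e` -/
  have hza : z ∈ I := hImem hz
  set W : EuclideanSpace ℝ (Fin 3) := s • e + d z • Jvec e + z • e2 with hW_def
  have hWz : frameCLM e (s, n₀ (τ, s, z), z) = W := hWeq s z hz
  have hconst : ∀ᶠ q in 𝓝 ((s, z) : ℝ × ℝ), fderiv ℝ θ (webMap e (fun q : ℝ × ℝ => d q.2) q) = c := by
    have hmem : {q : ℝ × ℝ | q.2 ∈ I} ∈ 𝓝 ((s, z) : ℝ × ℝ) := continuous_snd.continuousAt.preimage_mem_nhds (hI.mem_nhds hza)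
    filter_upwards [hmem] with q hq
    exact hsheet q.1 q.2 hq
  have hee : fderiv ℝ (fderiv ℝ θ) W e e = 0 := by
    have h := (nonhot_sheet_null_tangents hθ2 e (p := (s, z)) (hdd z hz).differentiableAt hconst).2.1 e
    simpa [webMap] using h
  have ha : fderiv ℝ (fderiv ℝ θ) W (Jvec e) (Jvec e) ≠ 0 := by
    obtain ⟨-, -, -, -, -, hκ, hridge, -⟩ := hpack (τ, s, z) hτ hz
    simp only at hκ hridge
    rw [hWz, fderiv_fderiv_const_mul_apply hθ2 σ W e e, fderiv_fderiv_const_mul_apply hθ2 σ W (Jvec e) (Jvec e), hee, mul_zero, zero_add] at hridge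
    intro h0
    rw [h0, mul_zero] at hridge
    linarith
  /- (4) the kinematic sheet-speed literal at `(τ, W)` -/
  set V : ℝ := fderiv ℝ n₀ (τ, s, z) ((1 : ℝ), (0 : ℝ), (0 : ℝ)) with hV_def
  have hkin : fderiv ℝ (fderiv ℝ (uncurry fun a y => σ * U (-1 + a) y 2)) (τ, W) ((1 : ℝ), V • Jvec e) ((0 : ℝ), Jvec e) = 0 := by
    have hT : IsOpen (Ioo (-1 / 2 : ℝ) (1 / 2)) := isOpen_Ioo
    have hτT : τ ∈ Ioo (-1 / 2 : ℝ) (1 / 2) := ⟨by linarith [(abs_lt.1 hτh).1], (abs_lt.1 hτh).2⟩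
    have hF2 : ContDiffOn ℝ 2 (uncurry fun a y => σ * U (-1 + a) y 2) (Ioo (-1 / 2 : ℝ) (1 / 2) ×ˢ (univ : Set (EuclideanSpace ℝ (Fin 3)))) :=
      contDiffOn_uncurry_signed hrate hcont hmild hdiv σ (n := 2) Subset.rfl
    have hm : HasDerivAt (fun a : ℝ => n₀ (a, s, z)) V τ :=
      (hn₀d s z hz).hasFDerivAt.comp_hasDerivAt τ (hasDerivAt_tauLine s z τ)
    -- criticality along `Je` at the web points of nearby times
    have hcrit : ∀ᶠ a in 𝓝 τ, fderiv ℝ (fun y => σ * U (-1 + a) y 2) ((fun s' : ℝ => s' • e) s + (fun a' : ℝ => n₀ (a', s, z)) a • (fun _ : ℝ => Jvec e) s +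
        z • EuclideanSpace.single 2 (1 : ℝ)) ((fun _ : ℝ => Jvec e) s) = 0 := by
      have hmem : {a : ℝ | |a| < δ'} ∈ 𝓝 τ := (isOpen_lt continuous_abs continuous_const).mem_nhds hτ
      filter_upwards [hmem] with a ha
      obtain ⟨-, -, -, hhor, -, -, -, -⟩ := hpack (a, s, z) ha hz
      simp only at hhor ⊢
      have hta : -1 + a < 0 := by linarith [(abs_lt.1 (lt_of_lt_of_le ha hδ'h.le)).2]
      have hθa : Differentiable ℝ (fun y => U (-1 + a) y 2) := (hθsm a hta).differentiable (by simp)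
      have hpt : s • e + n₀ (a, s, z) • Jvec e + z • EuclideanSpace.single 2 (1 : ℝ) = frameCLM e (s, n₀ (a, s, z), z) := by
        rw [frameCLM_apply]; rfl
      rw [hpt, fderiv_const_mul (hθa _), _root_.smul_apply, hhor (Jvec e) (by simp [Jvec]), smul_zero]
    have h := spacetimeHessian_sheetVelocity_normal_eq_zero (F := fun a y => σ * U (-1 + a) y 2) (Γ := fun s' : ℝ => s' • e)
      (ν := fun _ : ℝ => Jvec e) hT hF2 hτT hm s z hcrit
    have hpt : (fun s' : ℝ => s' • e) s + (fun a' : ℝ => n₀ (a', s, z)) τ • (fun _ : ℝ => Jvec e) s + z • EuclideanSpace.single 2 (1 : ℝ) = W := by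
      simp only
      rw [hW_def, hpar s z hz]; rfl
    rw [hpt] at h
    simpa using h
  /- (5) apply the sheet-level law -/
  have hmain := sonic_sheet_speed_law hrate hcont hmild hdiv hpol hμ3 hslabU hτh hτρ he2 hunit hI hIρ hd hch hsheet hQ0 s hza ha hσ hkin
  rw [hWz]
  exact hmain

/-- ★ **S3(b): THE CROSS-WEB VELOCITY ON THE SHEET, SOLVED** (same hypotheses): with `a = D²U₂(t,·)(W)[Je,Je]` (`≠ 0`, `= −σκ(τ,z)` by
`…Q4SonicSheetDataPackage`), `a₃ = D³U₂(t,·)(W)[Je,Je,Je]`, `d = n₀(τ,0,·)`, `μ = μ(t,z)`, `μ_z = ∂_zμ(t,z)`: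
`U(t,W)·Je = ∂_τn₀(τ,s,z) + (1 − μ)·a₃/a + d′(z)·σR(τ,z) + 2μ_z·d′(z)/(1 − μ)` — every term except `∂_τn₀` and `a₃` is `s`-free. -/
theorem crossVelocity_of_package
    (hrate : HasTypeITimeDecay C U) (hcont : ContinuousOn (uncurry U) (Iio (0 : ℝ) ×ˢ univ))
    (hmild : ∀ s t : ℝ, s < t → t < 0 → ∀ x, U t x = heatExtension (U s) (t - s) x - oseenDuhamel 1 s U U t x)
    (hdiv : ∀ t < 0, VectorCalculus.IsDivFree (U t))
    (hpol : ∀ s < 0, ∀ y, ⟪curl (U s) y, EuclideanSpace.single 2 1⟫_ℝ = 0)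
    (hσ : σ = 1 ∨ σ = -1) (hμ3 : ContDiff ℝ 3 (uncurry μ))
    (hslabU : ∀ t : ℝ, |t + 1| < ρ → ∀ x : EuclideanSpace ℝ (Fin 3), |x 2| < ρ → ∀ b : Fin 3, b ≠ 2 →
      fderiv ℝ (U t) x (EuclideanSpace.single 2 1) b = μ t (x 2) * fderiv ℝ (U t) x (EuclideanSpace.single b 1) 2)
    (hδ'ρ : δ' ≤ ρ) (hδ'h : δ' < 1 / 2) (he2 : e 2 = 0) (hunit : e 0 ^ 2 + e 1 ^ 2 = 1)
    (hpack : ∀ q : ℝ × ℝ × ℝ, |q.1| < δ' → |q.2.2| < δ' →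
        n₀ q ∈ Ioo (-r) r ∧
        σ * U (-1 + q.1) (frameCLM e (q.2.1, n₀ q, q.2.2)) 2 = R q.1 q.2.2 ∧
        (∀ n ∈ Icc (-r) r, n ≠ n₀ q → σ * U (-1 + q.1) (frameCLM e (q.2.1, n, q.2.2)) 2 < R q.1 q.2.2) ∧
        (∀ w : EuclideanSpace ℝ (Fin 3), w 2 = 0 → fderiv ℝ (fun y => U (-1 + q.1) y 2) (frameCLM e (q.2.1, n₀ q, q.2.2)) w = 0) ∧
        (∀ m : ℕ∞, ContDiffAt ℝ m n₀ q) ∧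
        0 < κt q.1 q.2.2 ∧
        fderiv ℝ (fderiv ℝ (fun y => σ * U (-1 + q.1) y 2)) (frameCLM e (q.2.1, n₀ q, q.2.2)) e e +
            fderiv ℝ (fderiv ℝ (fun y => σ * U (-1 + q.1) y 2)) (frameCLM e (q.2.1, n₀ q, q.2.2)) (Jvec e) (Jvec e) =
          -κt q.1 q.2.2 ∧
        κt q.1 q.2.2 * (fderiv ℝ n₀ q ((0 : ℝ), (0 : ℝ), (1 : ℝ))) ^ 2 =
          (deriv (deriv (R q.1)) q.2.2 - μ (-1 + q.1) q.2.2 * κt q.1 q.2.2) * (1 + (fderiv ℝ n₀ q ((0 : ℝ), (1 : ℝ), (0 : ℝ))) ^ 2))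
    {τ : ℝ} (hτ : |τ| < δ') (hson : ∃ A B : ℝ, ∀ z : ℝ, |z| < δ' → R τ z = A + B * z)
    (hpar : ∀ s z : ℝ, |z| < δ' → n₀ (τ, s, z) = n₀ (τ, (0 : ℝ), z)) (s : ℝ) {z : ℝ} (hz : |z| < δ')
    (ha : fderiv ℝ (fderiv ℝ (fun y => U (-1 + τ) y 2)) (frameCLM e (s, n₀ (τ, s, z), z)) (Jvec e) (Jvec e) ≠ 0) :
    U (-1 + τ) (frameCLM e (s, n₀ (τ, s, z), z)) 1 * e 0 - U (-1 + τ) (frameCLM e (s, n₀ (τ, s, z), z)) 0 * e 1 =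
      fderiv ℝ n₀ (τ, s, z) ((1 : ℝ), (0 : ℝ), (0 : ℝ))
        + (1 - μ (-1 + τ) z) * fderiv ℝ (fderiv ℝ (fderiv ℝ (fun y => U (-1 + τ) y 2))) (frameCLM e (s, n₀ (τ, s, z), z)) (Jvec e) (Jvec e) (Jvec e) /
            fderiv ℝ (fderiv ℝ (fun y => U (-1 + τ) y 2)) (frameCLM e (s, n₀ (τ, s, z), z)) (Jvec e) (Jvec e)
        + deriv (fun z' => n₀ (τ, (0 : ℝ), z')) z * (σ * R τ z)
        + 2 * deriv (μ (-1 + τ)) z * deriv (fun z' => n₀ (τ, (0 : ℝ), z')) z / (1 - μ (-1 + τ) z) := by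
  have hlaw := sonic_speed_law_of_package hrate hcont hmild hdiv hpol hσ hμ3 hslabU hδ'ρ hδ'h he2 hunit hpack hτ hson hpar s hz
  set t : ℝ := -1 + τ with ht_def
  set W := frameCLM e (s, n₀ (τ, s, z), z) with hW_def
  set a := fderiv ℝ (fderiv ℝ (fun y => U t y 2)) W (Jvec e) (Jvec e) with ha_def
  set a₃ := fderiv ℝ (fderiv ℝ (fderiv ℝ (fun y => U t y 2))) W (Jvec e) (Jvec e) (Jvec e) with ha₃_def
  set V := fderiv ℝ n₀ (τ, s, z) ((1 : ℝ), (0 : ℝ), (0 : ℝ)) with hV_def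
  set k := deriv (fun z' => n₀ (τ, (0 : ℝ), z')) z with hk_def
  have hσσ : σ * σ = 1 := by rcases hσ with h | h <;> simp [h]
  -- the value identity `U₂(t,W) = σ R(τ,z)`
  have hval : U t W 2 = σ * R τ z := by
    have h := (hpack (τ, s, z) hτ hz).2.1
    simp only at h
    have h2 : σ * (σ * U t (frameCLM e (s, n₀ (τ, s, z), z)) 2) = σ * R τ z := by rw [h]
    rw [← mul_assoc, hσσ, one_mul] at h2
    exact h2
  -- the characteristic relation `k² + μ = 0` (Huygens at `τ` with `∂_sn₀ = 0` and `R_zz = 0`)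
  have hn₀d : ∀ s' z' : ℝ, |z'| < δ' → DifferentiableAt ℝ n₀ (τ, s', z') := fun s' z' hz' =>
    ((hpack (τ, s', z') hτ hz').2.2.2.2.1 1).differentiableAt (by simp)
  have hdd : HasDerivAt (fun z' => n₀ (τ, (0 : ℝ), z')) (fderiv ℝ n₀ (τ, (0 : ℝ), z) ((0 : ℝ), (0 : ℝ), (1 : ℝ))) z :=
    (hn₀d 0 z hz).hasFDerivAt.comp_hasDerivAt z (hasDerivAt_zLine τ 0 z)
  have hns : fderiv ℝ n₀ (τ, (0 : ℝ), z) ((0 : ℝ), (1 : ℝ), (0 : ℝ)) = 0 := by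
    have h1 : HasDerivAt (fun a' : ℝ => n₀ (τ, a', z)) (fderiv ℝ n₀ (τ, (0 : ℝ), z) ((0 : ℝ), (1 : ℝ), (0 : ℝ))) 0 :=
      (hn₀d 0 z hz).hasFDerivAt.comp_hasDerivAt (0 : ℝ) (hasDerivAt_sLine τ z 0)
    have h2 : HasDerivAt (fun a' : ℝ => n₀ (τ, a', z)) 0 0 := by
      have e1 : (fun a' : ℝ => n₀ (τ, a', z)) = fun _ => n₀ (τ, (0 : ℝ), z) := by funext a'; exact hpar a' z hz
      rw [e1]; exact hasDerivAt_const _ _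
    exact h1.unique h2
  obtain ⟨A, B, hAB⟩ := hson
  have hR'' : deriv (deriv (R τ)) z = 0 := by
    have hRev : (R τ) =ᶠ[𝓝 z] fun w => A + B * w := by
      filter_upwards [(isOpen_lt continuous_abs continuous_const).mem_nhds hz] with w hw using hAB w hw
    have hev1 : deriv (R τ) =ᶠ[𝓝 z] fun _ => B := by
      filter_upwards [hRev.eventuallyEq_nhds] with w hw
      have hdAB : HasDerivAt (fun x : ℝ => A + B * x) B w := by
        simpa using ((hasDerivAt_id w).const_mul B).const_add A
      rw [hw.deriv_eq, hdAB.deriv]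
    rw [hev1.deriv_eq, deriv_const]
  have hQ0 : k ^ 2 + μ t z = 0 := by
    obtain ⟨-, -, -, -, -, hκ, -, hH⟩ := hpack (τ, (0 : ℝ), z) hτ hz
    simp only at hH hκ
    rw [hns, hR'', ← hdd.deriv] at hH
    have h2 : κt τ z * (k ^ 2 + μ t z) = 0 := by rw [hk_def]; nlinarith [hH]
    rcases mul_eq_zero.1 h2 with h3 | h3
    · exact absurd h3 hκ.ne'
    · exact h3
  have hμ1 : 1 - μ t z ≠ 0 := by
    intro h0
    have h1 : μ t z = 1 := by linarith
    rw [h1] at hQ0; nlinarith [sq_nonneg k]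
  -- solve the law for `U·Je`
  have hk2 : 1 + k ^ 2 = 1 - μ t z := by linarith [hQ0]
  rw [hval, hk2] at hlaw
  apply mul_right_cancel₀ ha
  have hx : (1 - μ t z) * a₃ / a * a = (1 - μ t z) * a₃ := div_mul_cancel₀ _ ha
  have hXY : 2 * deriv (μ t) z * k * a / (1 - μ t z) = 2 * deriv (μ t) z * k / (1 - μ t z) * a := by ring
  calc (U t W 1 * e 0 - U t W 0 * e 1) * a
      = V * a + (1 - μ t z) * a₃ + k * (σ * R τ z) * a + 2 * deriv (μ t) z * k / (1 - μ t z) * a := by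
        rw [← hXY]; linear_combination -hlaw
    _ = (V + (1 - μ t z) * a₃ / a + k * (σ * R τ z) + 2 * deriv (μ t) z * k / (1 - μ t z)) * a := by
        rw [add_mul, add_mul, add_mul, hx]


/-- **In case I the web speed is `s`-free:** if the webs are parallel at EVERY time of a neighbourhood of `τ` (`n₀(a,s,z) = n₀(a,0,z)` for `a` near `τ`)
and `n₀` is differentiable at `(τ,s,z)` and `(τ,0,z)`, then `∂_τn₀(τ,s,z) = ∂_τn₀(τ,0,z)`. -/
theorem webSpeed_sfree_of_parallel {τ s z : ℝ} (hpar : ∀ᶠ a in 𝓝 τ, n₀ (a, s, z) = n₀ (a, (0 : ℝ), z))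
    (h1 : DifferentiableAt ℝ n₀ (τ, s, z)) (h0 : DifferentiableAt ℝ n₀ (τ, (0 : ℝ), z)) :
    fderiv ℝ n₀ (τ, s, z) ((1 : ℝ), (0 : ℝ), (0 : ℝ)) = fderiv ℝ n₀ (τ, (0 : ℝ), z) ((1 : ℝ), (0 : ℝ), (0 : ℝ)) := by
  have hs : HasDerivAt (fun a : ℝ => n₀ (a, s, z)) (fderiv ℝ n₀ (τ, s, z) ((1 : ℝ), (0 : ℝ), (0 : ℝ))) τ :=
    h1.hasFDerivAt.comp_hasDerivAt τ (hasDerivAt_tauLine s z τ)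
  have hz : HasDerivAt (fun a : ℝ => n₀ (a, (0 : ℝ), z)) (fderiv ℝ n₀ (τ, (0 : ℝ), z) ((1 : ℝ), (0 : ℝ), (0 : ℝ))) τ :=
    h0.hasFDerivAt.comp_hasDerivAt τ (hasDerivAt_tauLine 0 z τ)
  exact hs.unique (hz.congr_of_eventuallyEq hpar)

end Summit.NavierStokesRegularity.NavierStokesRegularity.Theorems.PoloidalWindowDoorLrcModEntireQ4SonicSpeedLawPackage
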